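import Summits.ValiantsHypothesis.ValiantsHypothesis.Theorems.RigidityForcesSymmetryGrenetFirstOrderRankRigidAdjugate
import Summits.ValiantsHypothesis.ValiantsHypothesis.Theorems.RigidityForcesSymmetryGrenetFirstOrderRankRigidDirections

/-!
# Route RigidityForcesSymmetry — `GrenetFirstOrderRankRigid` (item stmt-ValiantsHypothesis-21029),
line `grenet_gauge`: stub `stub_linearRigid`, step 6 — assembling the gauge pair from vertex-pair functions

For the crux line `Cruxes/GrenetFirstOrderRankRigid/Lines/grenet_gauge.lean` (blueprint
`Lines/grenet_gauge-stub_linearRigid-PROOF.md`, §6).  The block analysis of the blueprint (§5) ends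
with GAUGE FUNCTIONS ON PAIRS OF VERTICES: `Pf, Qf : 2^[n] × 2^[n] → k` such that every coefficient
entry of the homogeneous direction has its gauge value
`(A'_v) i j = ε · ( -[C j is a v-head] · Pf (R i) (C j - p) + [R i is a v-tail] · Qf (R i + p) (C j) )`
(`v = (p, c)`; `R i`, `C j` the row / column vertices, `ε = (-1)^(e univ + e ∅)`), with `Pf = Qf` on
pairs of middle vertices (`≠ ∅, univ`), `Pf ∅ T = 0` and `Qf S univ = 0`.  This file performs the
INDEX BOOKKEEPING that turns such functions into the matrices `P i i' := Pf (R i) (R i')`,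
`Q j j' := Qf (C j) (C j')` and proves the conclusion of the homogeneous stub:
`P Λ = Λ Q` and `A'_v = P A_v - A_v Q` for all `v` (`grenet_gauge_of_pairFunctions`), where
`Λ = coeff_0 (Grenet.repr k n e)` and `A_v = coeff_{x_v} (Grenet.repr k n e)` as in the line.

Main statements: `grenet_coeffMatrix_mul_apply`, `grenet_mul_coeffMatrix_apply` (the products
`P A_v`, `A_v Q` with a signed arc-indicator matrix pick one vertex), `grenet_constMatrix_mul_apply`,
`grenet_mul_constMatrix_apply`, `grenet_gauge_of_pairFunctions`.  No new definitions.  VP ≠ VNP is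
not moved by this file (bookkeeping for a first-order statement about one explicit matrix family).
-/

noncomputable section

open MvPolynomial Matrix Finset

namespace Summit.ValiantsHypothesis.Theorems.RigidityForcesSymmetry.GrenetGauge

open Literature.Computability.AlgebraicComplexity

variable {k : Type*} [CommRing k] {n N : ℕ} (e : Finset (Fin n) ≃ Fin (N + 1))

/-- `P · Λ` for Grenet's constant part picks the row vertex of the column: with
`P i i' = Pf (R i) (R i')`, `(P Λ) i j = ε · [C j ≠ univ] · Pf (R i) (C j)`. [folklore] -/
theorem grenet_constMatrix_left_mul_apply (Pf : Finset (Fin n) → Finset (Fin n) → k)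
    {Λ : Matrix (Fin N) (Fin N) k} (hΛ : ∀ i j, Λ i j = coeff 0 (Grenet.repr k n e i j)) (i j : Fin N) :
    ((Matrix.of fun i i' : Fin N => Pf (e.symm ((e univ).succAbove i)) (e.symm ((e univ).succAbove i'))) * Λ) i j
      = (-1) ^ ((e univ : ℕ) + (e ∅ : ℕ)) *
        if e.symm ((e ∅).succAbove j) = univ then 0 else Pf (e.symm ((e univ).succAbove i)) (e.symm ((e ∅).succAbove j)) := by
  rw [Matrix.mul_apply]
  simp only [Matrix.of_apply, hΛ, coeff_zero_grenet_repr]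
  have h := sum_grenet_row e (fun S => Pf (e.symm ((e univ).succAbove i)) S *
    ((-1) ^ ((e univ : ℕ) + (e ∅ : ℕ)) * if S = e.symm ((e ∅).succAbove j) then (1 : k) else 0))
  rw [h]
  simp only [mul_ite, mul_one, mul_zero, Finset.sum_ite_eq', Finset.mem_univ, if_true]
  by_cases hj : e.symm ((e ∅).succAbove j) = univ
  · simp [hj]
  · simp [hj, Ne.symm hj, mul_comm]

/-- `Λ · Q` for Grenet's constant part picks the column vertex of the row: with
`Q j' j = Qf (C j') (C j)`, `(Λ Q) i j = ε · [R i ≠ ∅] · Qf (R i) (C j)`. [folklore] -/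
theorem grenet_constMatrix_right_mul_apply (Qf : Finset (Fin n) → Finset (Fin n) → k)
    {Λ : Matrix (Fin N) (Fin N) k} (hΛ : ∀ i j, Λ i j = coeff 0 (Grenet.repr k n e i j)) (i j : Fin N) :
    (Λ * Matrix.of fun j' j : Fin N => Qf (e.symm ((e ∅).succAbove j')) (e.symm ((e ∅).succAbove j))) i j
      = (-1) ^ ((e univ : ℕ) + (e ∅ : ℕ)) *
        if e.symm ((e univ).succAbove i) = ∅ then 0 else Qf (e.symm ((e univ).succAbove i)) (e.symm ((e ∅).succAbove j)) := by
  rw [Matrix.mul_apply]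
  simp only [Matrix.of_apply, hΛ, coeff_zero_grenet_repr]
  have h := sum_grenet_col e (fun T => ((-1) ^ ((e univ : ℕ) + (e ∅ : ℕ)) *
    if e.symm ((e univ).succAbove i) = T then (1 : k) else 0) * Qf T (e.symm ((e ∅).succAbove j)))
  rw [h]
  simp only [ite_mul, zero_mul, mul_ite, mul_zero, Finset.sum_ite_eq, Finset.mem_univ, if_true]
  by_cases hi : e.symm ((e univ).succAbove i) = ∅
  · simp [hi]
  · simp [hi]

/-- `P · A_v` for a coefficient matrix of Grenet's pencil picks the tail of the arc into the column:
`(P A_(p,c)) i j = -ε · [p ∈ C j ∧ |C j| = c + 1] · Pf (R i) (C j - p)`. [folklore] -/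
theorem grenet_coeffMatrix_left_mul_apply (Pf : Finset (Fin n) → Finset (Fin n) → k) (v : Fin n × Fin n)
    {A : Matrix (Fin N) (Fin N) k} (hA : ∀ i j, A i j = coeff (Finsupp.single v 1) (Grenet.repr k n e i j))
    (i j : Fin N) :
    ((Matrix.of fun i i' : Fin N => Pf (e.symm ((e univ).succAbove i)) (e.symm ((e univ).succAbove i'))) * A) i j
      = -((-1) ^ ((e univ : ℕ) + (e ∅ : ℕ))) *
        if v.1 ∈ e.symm ((e ∅).succAbove j) ∧ (e.symm ((e ∅).succAbove j)).card = (v.2 : ℕ) + 1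
        then Pf (e.symm ((e univ).succAbove i)) ((e.symm ((e ∅).succAbove j)).erase v.1) else 0 := by
  rw [Matrix.mul_apply]
  simp only [Matrix.of_apply, hA, coeff_single_grenet_repr]
  have h := sum_grenet_row e (fun S => Pf (e.symm ((e univ).succAbove i)) S *
    (-((-1) ^ ((e univ : ℕ) + (e ∅ : ℕ))) *
      if v.1 ∉ S ∧ e.symm ((e ∅).succAbove j) = insert v.1 S ∧ (v.2 : ℕ) = S.card then (1 : k) else 0))
  rw [h]
  -- the `univ` correction vanishes (`p ∉ univ` fails)
  have huniv : ¬ (v.1 ∉ (univ : Finset (Fin n)) ∧ e.symm ((e ∅).succAbove j) = insert v.1 univ ∧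
      (v.2 : ℕ) = (univ : Finset (Fin n)).card) := fun h => h.1 (Finset.mem_univ _)
  rw [if_neg huniv, mul_zero, mul_zero, sub_zero]
  -- the sum has at most one nonzero term, `S = C j - p`
  simp only [mul_ite, mul_one, mul_zero]
  by_cases hhead : v.1 ∈ e.symm ((e ∅).succAbove j) ∧ (e.symm ((e ∅).succAbove j)).card = (v.2 : ℕ) + 1
  · rw [if_pos hhead, Finset.sum_eq_single_of_mem ((e.symm ((e ∅).succAbove j)).erase v.1) (Finset.mem_univ _)]
    · rw [if_pos ⟨Finset.notMem_erase v.1 _, (Finset.insert_erase hhead.1).symm, by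
        rw [Finset.card_erase_of_mem hhead.1, hhead.2, Nat.add_sub_cancel]⟩, mul_comm]
    · intro S _ hS
      refine if_neg fun h => hS ?_
      rw [h.2.1, Finset.erase_insert h.1]
  · rw [if_neg hhead]
    refine Finset.sum_eq_zero fun S _ => if_neg fun h => hhead ⟨?_, ?_⟩
    · rw [h.2.1]
      exact Finset.mem_insert_self _ _
    · rw [h.2.1, Finset.card_insert_of_notMem h.1, h.2.2]

/-- `A_v · Q` for a coefficient matrix of Grenet's pencil picks the head of the arc out of the row:
`(A_(p,c) Q) i j = -ε · [p ∉ R i ∧ |R i| = c] · Qf (R i + p) (C j)`. [folklore] -/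
theorem grenet_coeffMatrix_right_mul_apply (Qf : Finset (Fin n) → Finset (Fin n) → k) (v : Fin n × Fin n)
    {A : Matrix (Fin N) (Fin N) k} (hA : ∀ i j, A i j = coeff (Finsupp.single v 1) (Grenet.repr k n e i j))
    (i j : Fin N) :
    (A * Matrix.of fun j' j : Fin N => Qf (e.symm ((e ∅).succAbove j')) (e.symm ((e ∅).succAbove j))) i j
      = -((-1) ^ ((e univ : ℕ) + (e ∅ : ℕ))) *
        if v.1 ∉ e.symm ((e univ).succAbove i) ∧ (v.2 : ℕ) = (e.symm ((e univ).succAbove i)).card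
        then Qf (insert v.1 (e.symm ((e univ).succAbove i))) (e.symm ((e ∅).succAbove j)) else 0 := by
  rw [Matrix.mul_apply]
  simp only [Matrix.of_apply, hA, coeff_single_grenet_repr]
  have h := sum_grenet_col e (fun T => (-((-1) ^ ((e univ : ℕ) + (e ∅ : ℕ))) *
      (if v.1 ∉ e.symm ((e univ).succAbove i) ∧ T = insert v.1 (e.symm ((e univ).succAbove i)) ∧
        (v.2 : ℕ) = (e.symm ((e univ).succAbove i)).card then (1 : k) else 0)) *
      Qf T (e.symm ((e ∅).succAbove j)))
  rw [h]
  -- the `∅` correction vanishes (`∅ = insert p S` fails)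
  have hempty : ¬ (v.1 ∉ e.symm ((e univ).succAbove i) ∧ (∅ : Finset (Fin n)) = insert v.1 (e.symm ((e univ).succAbove i)) ∧
      (v.2 : ℕ) = (e.symm ((e univ).succAbove i)).card) :=
    fun h => absurd (h.2.1 ▸ Finset.mem_insert_self v.1 _) (Finset.notMem_empty _)
  rw [if_neg hempty, mul_zero, zero_mul, sub_zero]
  simp only [mul_ite, mul_one, mul_zero, ite_mul, zero_mul]
  by_cases htail : v.1 ∉ e.symm ((e univ).succAbove i) ∧ (v.2 : ℕ) = (e.symm ((e univ).succAbove i)).card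
  · rw [if_pos htail, Finset.sum_eq_single_of_mem (insert v.1 (e.symm ((e univ).succAbove i))) (Finset.mem_univ _)]
    · rw [if_pos ⟨htail.1, rfl, htail.2⟩]
    · intro T _ hT
      exact if_neg fun h => hT h.2.1
  · rw [if_neg htail]
    exact Finset.sum_eq_zero fun T _ => if_neg fun h => htail ⟨h.1, h.2.2⟩

/-- **Assembly of the gauge pair from vertex-pair functions** (blueprint §6).  Let
`Λ = coeff_0 (Grenet.repr k n e)` and `A_v = coeff_{x_v} (Grenet.repr k n e)` be Grenet's pencil and let
`A'` be a homogeneous direction.  Suppose there are functions `Pf, Qf` on pairs of vertices such that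
every entry has its gauge value,
`(A'_v) i j = ε · ( -[p ∈ C j ∧ |C j| = c+1] · Pf (R i) (C j - p) + [p ∉ R i ∧ |R i| = c] · Qf (R i + p) (C j) )`
(`v = (p, c)`), that `Pf = Qf` on pairs of middle vertices, `Pf ∅ T = 0` for middle `T` and
`Qf S univ = 0` for middle `S`.  Then `P i i' := Pf (R i) (R i')`, `Q j j' := Qf (C j) (C j')` satisfy
`P Λ = Λ Q` and `A'_v = P A_v - A_v Q` for every `v` — the conclusion of the homogeneous form of
`stub_linearRigid`. [folklore] -/
theorem grenet_gauge_of_pairFunctions {Λ : Matrix (Fin N) (Fin N) k}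
    (hΛ : ∀ i j, Λ i j = coeff 0 (Grenet.repr k n e i j))
    {A : Fin n × Fin n → Matrix (Fin N) (Fin N) k}
    (hA : ∀ v i j, A v i j = coeff (Finsupp.single v 1) (Grenet.repr k n e i j))
    (A' : Fin n × Fin n → Matrix (Fin N) (Fin N) k) (Pf Qf : Finset (Fin n) → Finset (Fin n) → k)
    (hG : ∀ v i j, A' v i j = (-1) ^ ((e univ : ℕ) + (e ∅ : ℕ)) *
      (-(if v.1 ∈ e.symm ((e ∅).succAbove j) ∧ (e.symm ((e ∅).succAbove j)).card = (v.2 : ℕ) + 1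
          then Pf (e.symm ((e univ).succAbove i)) ((e.symm ((e ∅).succAbove j)).erase v.1) else 0)
        + (if v.1 ∉ e.symm ((e univ).succAbove i) ∧ (v.2 : ℕ) = (e.symm ((e univ).succAbove i)).card
          then Qf (insert v.1 (e.symm ((e univ).succAbove i))) (e.symm ((e ∅).succAbove j)) else 0)))
    (hPQ : ∀ S T : Finset (Fin n), S ≠ ∅ → S ≠ univ → T ≠ ∅ → T ≠ univ → Pf S T = Qf S T)
    (hP0 : ∀ T : Finset (Fin n), T ≠ ∅ → T ≠ univ → Pf ∅ T = 0)
    (hQ0 : ∀ S : Finset (Fin n), S ≠ ∅ → S ≠ univ → Qf S univ = 0) :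
    ∃ P Q : Matrix (Fin N) (Fin N) k, P * Λ = Λ * Q ∧ ∀ v, A' v = P * A v - A v * Q := by
  refine ⟨Matrix.of fun i i' : Fin N => Pf (e.symm ((e univ).succAbove i)) (e.symm ((e univ).succAbove i')),
    Matrix.of fun j' j : Fin N => Qf (e.symm ((e ∅).succAbove j')) (e.symm ((e ∅).succAbove j)), ?_, fun v => ?_⟩
  · refine Matrix.ext fun i j => ?_
    rw [grenet_constMatrix_left_mul_apply e Pf hΛ, grenet_constMatrix_right_mul_apply e Qf hΛ]
    congr 1
    have hRi : e.symm ((e univ).succAbove i) ≠ univ := grenet_row_ne_univ e i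
    have hCj : e.symm ((e ∅).succAbove j) ≠ ∅ := grenet_col_ne_empty e j
    by_cases hj : e.symm ((e ∅).succAbove j) = univ <;> by_cases hi : e.symm ((e univ).succAbove i) = ∅
    · rw [if_pos hj, if_pos hi]
    · rw [if_pos hj, if_neg hi, hj, hQ0 _ hi hRi]
    · rw [if_neg hj, if_pos hi, hi, hP0 _ hCj hj]
    · rw [if_neg hj, if_neg hi, hPQ _ _ hi hRi hCj hj]
  · refine Matrix.ext fun i j => ?_
    rw [Matrix.sub_apply, grenet_coeffMatrix_left_mul_apply e Pf v (hA v),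
      grenet_coeffMatrix_right_mul_apply e Qf v (hA v), hG]
    ring

end Summit.ValiantsHypothesis.Theorems.RigidityForcesSymmetry.GrenetGauge
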